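import Summits.SmoothPoincare4.SmoothPoincare4.Theorems.SullivanDualWitnessChargeCapDefs
import Mathlib.Analysis.Calculus.Deriv.Inv
import Mathlib.Analysis.Normed.Field.Lemmas
import Mathlib.Topology.Bornology.BoundedOperation

/-!
# Stub `stub_leafFloc` of skeleton v15 (crux `WitnessCharge`, stmt-SmoothPoincare4-7824, line
`Sketch`, lead c8) — one renormalised leaf is a pencil member

Registered helper `helper_leafFloc_member`. Fix cap data `D`, one leaf `(Ua, Va)` of the local
family of embedded `JX`-spheres (smooth, `Va z = Ua z⁻¹`, `JX`-holomorphic, `Ua` injective,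
`Va 0 ∉ range Ua`) with its intercept-chart data (the leaf meets the added line `E` on the `V`-disc
`‖w‖ ≤ 1/2` exactly at `w₀`, `‖w₀‖ < 1/4`, where `Va w₀ = capPt b`; the cap coordinates of the
`V`-disc are holomorphic in `w`; the `t`-coordinate `g w = (capCoord (Va w)).1` has a simple zero at
`w₀`), the puncture parametrisation `P` (`P ξ' = Va (w₀ + ξ'⁻¹)` for `ξ' ≠ 0`) with its
set-theoretic properties (the conclusions of `helper_leafFloc_param`, file `…V15LeafFlocParam`,
taken as hypotheses: the `U`-formula near `ξ' = 0`, `range P = leaf ∩ range ι`, injectivity, the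
flat coordinates of the `V`-disc), and constants `c ≠ 0`, `d` with the Laurent asymptotics
`(g (w₀ + η))⁻¹ − (c η)⁻¹ → d` as `η → 0`, `η ≠ 0` (the conclusion of `helper_leafFloc_laurent`,
file `…V15LeafFlocLaurent`, for `c = g'(w₀)`, `d = −(g''(w₀)/2)/c²`, taken as a hypothesis).

If `F : ℂ → Σ ∖ p` satisfies `ι (F ξ) = P (c (ξ − d))` and is smooth with injective differential
(both supplied by the joint-smoothness file of the stub), then `F` is a PENCIL MEMBER of intercept
`b` (`IsPencilMember J F b`) and `range (ι ∘ F) = (range Ua ∪ {Va 0}) ∩ range ι`: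

* injective (so non-constant): `P` is injective, `c ≠ 0`;
* `J`-holomorphic: `d(ι ∘ F) = dF` (`dι = id`), `J = JX ∘ ι`, and near every `ξ` the map
  `ι ∘ F = P ∘ affine` is `Ua ∘ m` or `Va ∘ m` with `m` a Möbius map, holomorphic at `ξ`
  (`leafFloc_mfderiv_comp_apply_I_mul`);
* proper: `P ξ' → Va w₀ = capPt b ∉ ι(K)` as `ξ' → ∞`, so `F⁻¹ K = (ι ∘ F)⁻¹ (ι K)` is closed and
  co-eventually empty, hence compact;
* asymptotics: for `ξ' = c (ξ − d)` large, `η = ξ'⁻¹`, the point `F ξ` has flat coordinates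
  `((g (w₀ + η))⁻¹, (capCoord (Va (w₀ + η))).2)`; the second tends to `(capCoord (capPt b)).2 = b`,
  and by the Laurent hypothesis `(g (w₀ + η))⁻¹ − ξ = [(g (w₀ + η))⁻¹ − (c η)⁻¹] − d → 0`.
-/

noncomputable section

set_option linter.dupNamespace false

open scoped Manifold ContDiff Topology
open Set Filter Bornology Literature.Geometry.Symplectic Literature.Topology.FourManifolds

namespace Summit.SmoothPoincare4.SmoothPoincare4.Theorems.WitnessCharge.PencilIncompleteness

/-- The affine-inverted parameter `ξ ↦ (c (ξ − d))⁻¹` (`c ≠ 0`) tends to `0` through nonzero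
values at infinity (along `cocompact ℂ`). -/
theorem leafFloc_tendsto_inv_affine_cocompact {c : ℂ} (hc : c ≠ 0) (d : ℂ) :
    Tendsto (fun ξ : ℂ => (c * (ξ - d))⁻¹) (cocompact ℂ) (nhdsWithin (0 : ℂ) {0}ᶜ) := by
  rw [← Metric.cobounded_eq_cocompact]
  exact Filter.tendsto_inv₀_cobounded'.comp
    ((Filter.tendsto_mul_left_cobounded hc).comp (tendsto_sub_const_cobounded d))

/-- **Pointwise holomorphic reparametrisation.** If `u : ℂ → M` is `J`-holomorphic and
differentiable at `g z`, and `g : ℂ → ℂ` is complex differentiable at `z`, then `u ∘ g` satisfies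
the `J`-holomorphicity identity at `z`:
`d(u ∘ g)_z(iζ) = du(Dg(iζ)) = du(i Dg ζ) = J du(Dg ζ) = J d(u ∘ g)_z ζ` (the pointwise form of
`IsJHolomorphic.comp_of_differentiable` of `Literature/…/JHolomorphicReparametrisation.lean`). -/
theorem leafFloc_mfderiv_comp_apply_I_mul {E : Type*} [NormedAddCommGroup E] [NormedSpace ℝ E]
    {H : Type*} [TopologicalSpace H] {I : ModelWithCorners ℝ E H} {M : Type*}
    [TopologicalSpace M] [ChartedSpace H M]
    {J : ∀ x : M, TangentSpace I x →L[ℝ] TangentSpace I x} {u : ℂ → M}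
    (hJ : IsJHolomorphic I J u) {g : ℂ → ℂ} {z : ℂ} (hg : DifferentiableAt ℂ g z)
    (hu : MDifferentiableAt 𝓘(ℝ, ℂ) I u (g z)) (ζ : ℂ) :
    mfderiv 𝓘(ℝ, ℂ) I (u ∘ g) z (Complex.I * ζ) =
      J (u (g z)) (mfderiv 𝓘(ℝ, ℂ) I (u ∘ g) z ζ) := by
  have hg' : HasMFDerivAt 𝓘(ℝ, ℂ) 𝓘(ℝ, ℂ) g z ((fderiv ℂ g z).restrictScalars ℝ) :=
    (hg.hasFDerivAt.restrictScalars ℝ).hasMFDerivAt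
  rw [(hu.hasMFDerivAt.comp z hg').mfderiv]
  have e1 : ((fderiv ℂ g z).restrictScalars ℝ) (Complex.I * ζ) = Complex.I * fderiv ℂ g z ζ := by
    simp only [ContinuousLinearMap.coe_restrictScalars']
    rw [← smul_eq_mul, ContinuousLinearMap.map_smul, smul_eq_mul]
  calc ((mfderiv 𝓘(ℝ, ℂ) I u (g z)).comp ((fderiv ℂ g z).restrictScalars ℝ)) (Complex.I * ζ)
        = mfderiv 𝓘(ℝ, ℂ) I u (g z) (Complex.I * fderiv ℂ g z ζ) :=
          congrArg (mfderiv 𝓘(ℝ, ℂ) I u (g z)) e1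
    _ = J (u (g z)) (mfderiv 𝓘(ℝ, ℂ) I u (g z) (fderiv ℂ g z ζ)) := hJ (g z) _
    _ = J (u (g z))
          (((mfderiv 𝓘(ℝ, ℂ) I u (g z)).comp ((fderiv ℂ g z).restrictScalars ℝ)) ζ) := rfl

variable {S : HomotopySphere 4} {p : S.carrier}
  {J : ∀ x : punctured p, TangentSpace (𝓡 4) x →L[ℝ] TangentSpace (𝓡 4) x} {ε' : ℝ}

/-- `ι` is injective (it has the left inverse `ιinv`). -/
theorem CapData.leafFloc_ι_injective (D : CapData S p J ε') : Function.Injective D.ι := fun x y h => by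
  rw [← D.ιinv_ι x, h, D.ιinv_ι]

/-- `JX` at equal base points (transport of the point in `D.JX y v`). -/
theorem CapData.leafFloc_JX_congr_point (D : CapData S p J ε') {y y' : D.X} (h : y = y')
    (v : EuclideanSpace ℝ (Fin 4)) : D.JX y v = D.JX y' v := by
  subst h; rfl

/-- The cap coordinates of the point `capPt σ` of the added line are `(0, σ)`. -/
theorem CapData.leafFloc_capCoord_capPt (D : CapData S p J ε') (σ : ℂ) :
    D.capCoord (D.capPt σ) = (0, σ) := by
  rw [← D.capInv_zero σ]
  exact D.capCoord_capInv _ (by simpa using D.ρ_pos)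

/-- For a map `F : ℂ → Σ ∖ p` smooth at `ξ`, the differential of `ι ∘ F` at `ξ` is that of `F`
(`dι = id`). -/
theorem CapData.leafFloc_mfderiv_ι_comp (D : CapData S p J ε') {F : ℂ → punctured p} {ξ : ℂ}
    (hF : ContMDiffAt 𝓘(ℝ, ℂ) (𝓡 4) ∞ F ξ) :
    mfderiv 𝓘(ℝ, ℂ) (𝓡 4) (D.ι ∘ F) ξ = mfderiv 𝓘(ℝ, ℂ) (𝓡 4) F ξ := by
  have h1 : HasMFDerivAt 𝓘(ℝ, ℂ) (𝓡 4) F ξ (mfderiv 𝓘(ℝ, ℂ) (𝓡 4) F ξ) :=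
    (hF.mdifferentiableAt (by simp)).hasMFDerivAt
  rw [((D.hasMFDerivAt_ι (F ξ)).comp ξ h1).mfderiv]
  ext v
  rfl

/-- **Registered helper `helper_leafFloc_member` — one renormalised leaf of the cap model's local
family is a pencil member.** See the module docstring for the statement and the proof. -/
theorem helper_leafFloc_member :
    ∀ (S : HomotopySphere 4) (p : S.carrier)
      (J : ∀ x : punctured p, TangentSpace (𝓡 4) x →L[ℝ] TangentSpace (𝓡 4) x) (ε' : ℝ)
      (D : CapData S p J ε') (Ua Va : ℂ → D.X) (w₀ c d b : ℂ) (P : ℂ → D.X)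
      (F : ℂ → punctured p),
      ContMDiff 𝓘(ℝ, ℂ) (𝓡 4) ∞ Ua → ContMDiff 𝓘(ℝ, ℂ) (𝓡 4) ∞ Va →
      IsJHolomorphic (𝓡 4) (fun y => D.JX y) Ua → IsJHolomorphic (𝓡 4) (fun y => D.JX y) Va →
      DifferentiableOn ℂ (fun w => D.capCoord (Va w)) (Metric.ball 0 2⁻¹) →
      c ≠ 0 →
      Filter.Tendsto (fun η : ℂ => ((D.capCoord (Va (w₀ + η))).1)⁻¹ - (c * η)⁻¹)
        (nhdsWithin (0 : ℂ) {0}ᶜ) (nhds d) →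
      Va w₀ = D.capPt b → ‖w₀‖ < 4⁻¹ →
      (∀ ξ' : ℂ, ξ' ≠ 0 → P ξ' = Va (w₀ + ξ'⁻¹)) →
      (∀ ξ' : ℂ, 1 + w₀ * ξ' ≠ 0 → P ξ' = Ua (ξ' / (1 + w₀ * ξ'))) →
      (∀ ξ' : ℂ, P ξ' ∈ range D.ι) →
      range P = (range Ua ∪ {Va 0}) ∩ range D.ι →
      Function.Injective P →
      (∀ w : ℂ, ‖w‖ < 2⁻¹ → w ≠ w₀ → (D.capCoord (Va w)).1 ≠ 0 ∧
        ∃ x : punctured p, Va w = D.ι x ∧ InPuncturedChartBall p ε' x ∧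
          Ycoord p x = (((D.capCoord (Va w)).1)⁻¹, (D.capCoord (Va w)).2)) →
      (∀ ξ : ℂ, D.ι (F ξ) = P (c * (ξ - d))) →
      ContMDiff 𝓘(ℝ, ℂ) (𝓡 4) ∞ F →
      (∀ ξ : ℂ, Function.Injective (mfderiv 𝓘(ℝ, ℂ) (𝓡 4) F ξ)) →
      IsPencilMember J F b ∧ range (D.ι ∘ F) = (range Ua ∪ {Va 0}) ∩ range D.ι := by
  intro S p J ε' D Ua Va w₀ c d b P F hUsm hVsm hUj hVj hVdiff hc0 hL hVw₀ hw₀ hPne hPU hPι hrange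
    hPinj hflat hF hFsm hFimm
  -- the `t`-coordinate of the `V`-disc
  set g : ℂ → ℂ := fun w => (D.capCoord (Va w)).1 with hg
  have hw₀b : w₀ ∈ Metric.ball (0 : ℂ) 2⁻¹ := by
    rw [Metric.mem_ball, dist_zero_right]; exact hw₀.trans (by norm_num)
  have hcc0 : D.capCoord (Va w₀) = (0, b) := by rw [hVw₀, D.leafFloc_capCoord_capPt]
  -- `F ξ` is THE point `x` with `ι x = P (c (ξ - d))`
  have hFx : ∀ ξ, ∀ x : punctured p, P (c * (ξ - d)) = D.ι x → F ξ = x := fun ξ x hx =>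
    D.leafFloc_ι_injective ((hF ξ).trans hx)
  -- (1) injectivity
  have hFinj : Function.Injective F := by
    intro ξ₁ ξ₂ h
    have h' := hPinj ((hF ξ₁).symm.trans ((congrArg D.ι h).trans (hF ξ₂)))
    have : ξ₁ - d = ξ₂ - d := mul_left_cancel₀ hc0 h'
    exact sub_left_inj.1 this  -- `a - d = b - d ↔ a = b`
  -- (2) `J`-holomorphicity
  have hJF : IsJHolomorphic (𝓡 4) J F := by
    intro ξ ζ
    rw [← D.JX_ι (F ξ), ← D.leafFloc_mfderiv_ι_comp (hFsm ξ)]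
    by_cases hA : 1 + w₀ * (c * (ξ - d)) = 0
    · -- the `V`-piece: `c (ξ - d) ≠ 0`
      have hξ0 : c * (ξ - d) ≠ 0 := by
        intro h0; rw [h0, mul_zero, add_zero] at hA; exact one_ne_zero hA
      set m : ℂ → ℂ := fun ζ => w₀ + (c * (ζ - d))⁻¹ with hm
      have hopen : IsOpen {ζ : ℂ | c * (ζ - d) ≠ 0} := isOpen_ne_fun (by fun_prop) continuous_const
      have hev : (D.ι ∘ F) =ᶠ[𝓝 ξ] (Va ∘ m) := by
        filter_upwards [hopen.mem_nhds hξ0] with ζ hζ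
        show D.ι (F ζ) = Va (m ζ)
        rw [hF ζ, hPne _ hζ]
      have hmd : DifferentiableAt ℂ m ξ :=
        (((differentiableAt_id.sub_const d).const_mul c).inv hξ0).const_add w₀
      have hVd : MDifferentiableAt 𝓘(ℝ, ℂ) (𝓡 4) Va (m ξ) :=
        (hVsm (m ξ)).mdifferentiableAt (by simp)
      rw [hev.mfderiv_eq]
      have key := leafFloc_mfderiv_comp_apply_I_mul (I := 𝓡 4) (J := fun y => D.JX y) hVj hmd hVd ζ
      have hpt : Va (m ξ) = D.ι (F ξ) := by rw [hF ξ, hPne _ hξ0]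
      exact key.trans (D.leafFloc_JX_congr_point hpt _)
    · -- the `U`-piece
      set m : ℂ → ℂ := fun ζ => (c * (ζ - d)) / (1 + w₀ * (c * (ζ - d))) with hm
      have hopen : IsOpen {ζ : ℂ | 1 + w₀ * (c * (ζ - d)) ≠ 0} :=
        isOpen_ne_fun (by fun_prop) continuous_const
      have hev : (D.ι ∘ F) =ᶠ[𝓝 ξ] (Ua ∘ m) := by
        filter_upwards [hopen.mem_nhds hA] with ζ hζ
        show D.ι (F ζ) = Ua (m ζ)
        rw [hF ζ, hPU _ hζ]
      have hmd : DifferentiableAt ℂ m ξ := by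
        refine DifferentiableAt.div ((differentiableAt_id.sub_const d).const_mul c) ?_ hA
        exact (((differentiableAt_id.sub_const d).const_mul c).const_mul w₀).const_add 1
      have hUd : MDifferentiableAt 𝓘(ℝ, ℂ) (𝓡 4) Ua (m ξ) :=
        (hUsm (m ξ)).mdifferentiableAt (by simp)
      rw [hev.mfderiv_eq]
      have key := leafFloc_mfderiv_comp_apply_I_mul (I := 𝓡 4) (J := fun y => D.JX y) hUj hmd hUd ζ
      have hpt : Ua (m ξ) = D.ι (F ξ) := by rw [hF ξ, hPU _ hA]
      exact key.trans (D.leafFloc_JX_congr_point hpt _)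
  -- (3) the limit of `ι ∘ F` at infinity is the point `Va w₀ = capPt b` of `E`
  have hη : Tendsto (fun ξ : ℂ => (c * (ξ - d))⁻¹) (cocompact ℂ) (𝓝[≠] 0) :=
    leafFloc_tendsto_inv_affine_cocompact hc0 d
  have hη0 : Tendsto (fun ξ : ℂ => (c * (ξ - d))⁻¹) (cocompact ℂ) (𝓝 0) :=
    hη.mono_right nhdsWithin_le_nhds
  have hne : ∀ᶠ ξ in cocompact ℂ, c * (ξ - d) ≠ 0 := by
    have h1 : ∀ᶠ ξ in cocompact ℂ, (c * (ξ - d))⁻¹ ∈ ({0}ᶜ : Set ℂ) := hη self_mem_nhdsWithin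
    exact h1.mono fun ξ h h0 => h (by rw [h0, inv_zero]; exact mem_singleton _)
  have hwlim : Tendsto (fun ξ : ℂ => w₀ + (c * (ξ - d))⁻¹) (cocompact ℂ) (𝓝 w₀) := by
    have e : Tendsto (fun ξ : ℂ => w₀ + (c * (ξ - d))⁻¹) (cocompact ℂ) (𝓝 (w₀ + 0)) :=
      tendsto_const_nhds.add hη0
    rwa [add_zero] at e
  have hQlim : Tendsto (D.ι ∘ F) (cocompact ℂ) (𝓝 (Va w₀)) := by
    have h1 : Tendsto (fun ξ => Va (w₀ + (c * (ξ - d))⁻¹)) (cocompact ℂ) (𝓝 (Va w₀)) :=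
      (hVsm.continuous.tendsto w₀).comp hwlim
    refine h1.congr' ?_
    filter_upwards [hne] with ξ hξ
    show Va (w₀ + (c * (ξ - d))⁻¹) = D.ι (F ξ)
    rw [hF ξ, hPne _ hξ]
  -- (4) properness
  have hQc : Continuous (D.ι ∘ F) := D.contMDiff_ι.continuous.comp hFsm.continuous
  have hproper : ∀ K : Set (punctured p), IsCompact K → IsCompact (F ⁻¹' K) := by
    intro K hK
    have hK' : IsCompact (D.ι '' K) := hK.image D.contMDiff_ι.continuous
    have hpre : F ⁻¹' K = (D.ι ∘ F) ⁻¹' (D.ι '' K) := by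
      ext ξ
      simp only [mem_preimage, Function.comp_apply]
      refine ⟨fun h => ⟨F ξ, h, rfl⟩, ?_⟩
      rintro ⟨k, hk, hkξ⟩
      rwa [← D.leafFloc_ι_injective hkξ]
    have hclosed : IsClosed (F ⁻¹' K) := by
      rw [hpre]; exact hK'.isClosed.preimage hQc
    have hnot : Va w₀ ∈ (D.ι '' K)ᶜ := by
      rintro ⟨k, -, hk⟩
      exact D.ι_ne_capPt k b (hk.trans hVw₀)
    have hev : ∀ᶠ ξ in cocompact ℂ, (D.ι ∘ F) ξ ∈ (D.ι '' K)ᶜ :=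
      hQlim (hK'.isClosed.isOpen_compl.mem_nhds hnot)
    rw [Filter.Eventually, Filter.mem_cocompact] at hev
    obtain ⟨C, hC, hCsub⟩ := hev
    refine hC.of_isClosed_subset hclosed fun ξ hξ => ?_
    by_contra hξC
    have := hCsub hξC
    rw [hpre] at hξ
    exact this hξ
  -- (5) the flat coordinates of `F ξ` for `ξ` large
  have hsmall : ∀ᶠ ξ in cocompact ℂ, ‖(c * (ξ - d))⁻¹‖ < 4⁻¹ := by
    have : Metric.ball (0 : ℂ) 4⁻¹ ∈ 𝓝 (0 : ℂ) := Metric.ball_mem_nhds 0 (by norm_num)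
    filter_upwards [hη0 this] with ξ hξ
    rw [mem_preimage, Metric.mem_ball, dist_zero_right] at hξ
    exact hξ
  have hcoord : ∀ᶠ ξ in cocompact ℂ,
      Ycoord p (F ξ) = ((g (w₀ + (c * (ξ - d))⁻¹))⁻¹,
        (D.capCoord (Va (w₀ + (c * (ξ - d))⁻¹))).2) := by
    filter_upwards [hne, hsmall] with ξ hξ hsm
    set η := (c * (ξ - d))⁻¹ with hηdef
    have hηne : η ≠ 0 := inv_ne_zero hξ
    have hw : ‖w₀ + η‖ < 2⁻¹ := by
      calc ‖w₀ + η‖ ≤ ‖w₀‖ + ‖η‖ := norm_add_le _ _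
        _ < 4⁻¹ + 4⁻¹ := add_lt_add hw₀ hsm
        _ = 2⁻¹ := by norm_num
    have hwne : w₀ + η ≠ w₀ := fun h => hηne (by simpa using h)
    obtain ⟨-, x, hx, -, hY⟩ := hflat (w₀ + η) hw hwne
    have hFξ : F ξ = x := hFx ξ x (by rw [hPne _ hξ, ← hηdef, hx])
    rw [hFξ, hY]
  -- (6) second coordinate → b
  have hcont : ContinuousAt (fun w => D.capCoord (Va w)) w₀ :=
    (hVdiff.differentiableAt (Metric.isOpen_ball.mem_nhds hw₀b)).continuousAt
  have hT2 : Tendsto (fun ξ : ℂ => (Ycoord p (F ξ)).2) (cocompact ℂ) (𝓝 b) := by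
    have h1 : Tendsto (fun ξ : ℂ => (D.capCoord (Va (w₀ + (c * (ξ - d))⁻¹))).2) (cocompact ℂ)
        (𝓝 (D.capCoord (Va w₀)).2) :=
      (continuous_snd.tendsto _).comp ((hcont.tendsto).comp hwlim)
    rw [hcc0] at h1
    refine h1.congr' ?_
    filter_upwards [hcoord] with ξ hξ
    rw [hξ]
  -- (7) first coordinate: the Laurent lemma
  have hT1 : Tendsto (fun ξ : ℂ => (Ycoord p (F ξ)).1 - ξ) (cocompact ℂ) (𝓝 0) := by
    have h1 : Tendsto (fun ξ : ℂ => ((g (w₀ + (c * (ξ - d))⁻¹))⁻¹ -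
        (c * (c * (ξ - d))⁻¹)⁻¹) - d) (cocompact ℂ) (𝓝 (d - d)) :=
      (hL.comp hη).sub tendsto_const_nhds
    rw [sub_self] at h1
    refine h1.congr' ?_
    filter_upwards [hcoord, hne] with ξ hξ hξne
    rw [hξ]
    show (g (w₀ + (c * (ξ - d))⁻¹))⁻¹ - (c * (c * (ξ - d))⁻¹)⁻¹ - d =
      (g (w₀ + (c * (ξ - d))⁻¹))⁻¹ - ξ
    rw [mul_inv_rev c ((c * (ξ - d))⁻¹), inv_inv, mul_comm c (ξ - d), mul_inv_cancel_right₀ hc0]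
    ring
  -- (8) the range
  have hrangeF : range (D.ι ∘ F) = (range Ua ∪ {Va 0}) ∩ range D.ι := by
    rw [← hrange]
    ext y
    simp only [mem_range, Function.comp_apply]
    constructor
    · rintro ⟨ξ, rfl⟩; exact ⟨_, (hF ξ).symm⟩
    · rintro ⟨ξ', rfl⟩
      refine ⟨ξ' / c + d, ?_⟩
      rw [hF, add_sub_cancel_right, mul_div_cancel₀ _ hc0]
  refine ⟨⟨⟨hFsm, ⟨0, 1, fun h => zero_ne_one (hFinj h)⟩, hJF⟩, hFinj, hFimm, hproper, hT1, hT2⟩,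
    hrangeF⟩

end Summit.SmoothPoincare4.SmoothPoincare4.Theorems.WitnessCharge.PencilIncompleteness
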